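import Summits.QuantumFields.YangMills.Theorems.UnitScaleTiltFluctuationComparisonRegPrGlobalSlack
import Summits.QuantumFields.YangMills.Theorems.UnitScaleTiltFluctuationComparisonRegPrPrintChiLine

/-!
# `UnitScaleTiltFluctuationComparisonRegPrGlobalSlackOn` — KING'S SLACK ROW READ ON A SUB-PREDICATE OF THE WINDOW, AND ITS χ-RESTRICTED SOCKET
# (crux `FluctuationComparisonRegPrL`, stmt-QuantumFields-19935, STUB 4′ at L ∈ {3,5}; OWNER RULING ym3-torus-plan g21-№4 §A2 — the def `GlobalSupRateTSlackOn` and bridge (b1))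

Seat ym3-torus-p2 g14 (lane A on 4′; the lineage that ported p523985 `…GlobalSlack`).  RULING g21-№4 §A2 rules the CURRENCY of the inner piece (i)* of a 4′ split at
`L < 7`: «K1a-ON-χ», i.e. 3⁗'s input row `GlobalSlack.GlobalSupRateTSlack` with every sup over window data RESTRICTED to a sub-predicate `S` (to be the doubly-χ_μ-good data,
`S := PrintChi.ChiGood F γ b₀ p₀ ε₀ μ`), consumed through the S-parametric twin of the landed counting lemma `GlobalSlack.cauchyAtHeights_of_globalSupRateTSlack`:

  §1 `GlobalSupRateTSlackOn D S b₀ p₀ a σ C` := `∃ c, ∀ K n (h : n ≤ K) V, PlaqSmall (θ n) V → S K n h V → S (K+1) n _ V →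
        |PintH (K+1) n V − PintH K n V − c K n| ≤ C·#Site(F.P n)·(θ(n)²·L^{−a(K−n)} + θ(n)^σ)`   (display-only; `on_of_global`, `on_mono`, `on_true_iff`);
  §2 the counting, FACTORED: `summable_slackRadii` — along `n = ⌊K/m⌋`, `m > (3+a)/a`, a geometric threshold profile `θ(n) ≤ C_θρⁿ` with `ρ^σL³ < 1` makes the radii
        `r′_K = C·|𝕋_{⌊K/m⌋}|·(θ(⌊K/m⌋)²L^{−a(K−⌊K/m⌋)} + θ(⌊K/m⌋)^σ)` summable (the body of the port's `cauchyAtHeights_of_globalSupRateTSlack`, now reusable);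
  §3 **(b1) `cauchyOn_of_globalSupRateTSlackOn`**: `GlobalSupRateTSlackOn D S b₀ p₀ a σ C ⟹ PrintChi.PintCauchyOn F γ b₀ p₀ S m D.PintH` (+ the `σ ≥ 7` sharp-profile form and the
        registered-shape slot `levelCauchyOnOfGlobalSupRateTSlackOn_dec`, `∀ S` after the family) — pure counting, no `L`-threshold, so it serves `L ∈ {3,5}`.
With ★ym-ust-19935-r1 g0's `PrintChi.stub_logComparisonSmallBlocks_of_repOnChi_cauchyOnChi_edge` (p530007) and `twoSidedRepOn_of_repAt` this is the socket (b2) of §A2.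
Bookkeeping only; nothing of [Balaban1985UV3] / [King1986] is asserted (the `def` is a hypothesis schema).

References: C. King, CMP 102 (1986) 649–677 [King1986] (Thm 3.4 (3.9) p.656, (3.12)–(3.13) p.657); T. Bałaban, CMP 102 (1985) 255–275 [Balaban1985UV3] ((7) p.257, (47) p.267, (57) p.270).
-/

noncomputable section

open MeasureTheory Filter Topology
open Literature.MathematicalPhysics.QuantumFieldTheory.Balaban1983to89
open Literature.MathematicalPhysics.QuantumFieldTheory.Balaban1983to89.T3ContinuumYM3Torus
open Literature.MathematicalPhysics.QuantumFieldTheory.Balaban1983to89.T3LevelShift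
open Literature.MathematicalPhysics.QuantumFieldTheory.Balaban1983to89.T3UnitScaleTilt
open Literature.MathematicalPhysics.QuantumFieldTheory.Balaban1983to89.T3LogComparisonSocket
open Literature.MathematicalPhysics.QuantumFieldTheory.Balaban1983to89.T3AlphaInputsAC
open Literature.MathematicalPhysics.QuantumFieldTheory.Balaban1983to89.T3AlphaPolymerSocket
open Literature.MathematicalPhysics.QuantumFieldTheory.Balaban1983to89.T3AlphaInputsACTwoRunLevel
open Summit.QuantumFields.YangMills.Theorems.LogComparisonPolymerBudget
open Summit.QuantumFields.YangMills.Theorems.GlobalSlack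
open Summit.QuantumFields.YangMills.Theorems.PrintChi (PintCauchyOn)

namespace Summit.QuantumFields.YangMills.Theorems.GlobalSlackOn

variable {F : T3Family} {γ : ℝ}

/-- The type of a sub-predicate of the window data (run `K`, height `n ≤ K`, height-`n` field), as read by `PrintChi.TwoSidedRepOn` / `PrintChi.PintCauchyOn`. -/
abbrev WinPred (F : T3Family) : Type :=
  (K n : ℕ) → n ≤ K → GaugeField (F.P n) 0 (Matrix.specialUnitaryGroup (Fin 2) ℂ) → Prop

/-! ## §1 The slack row on a sub-predicate -/

section Defs

variable (D : AlphaDataT3 F γ)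

/-- **KING'S SLACK ROW ON A SUB-PREDICATE `S` OF THE WINDOW** (hypothesis schema, never asserted; OWNER RULING g21-№4 §A2): the landed `GlobalSlack.GlobalSupRateTSlack`
with its sup over the `θ(n)`-window restricted to the data that are `S`-good for BOTH runs `K` and `K+1` — e.g. `S := PrintChi.ChiGood F γ b₀ p₀ ε₀ μ`, print's `χ_k` of
(47) with margin `μ`. [cite: King1986, Thm 3.4 (3.9) p.656; Balaban1985UV3, (47) p.267] -/
def GlobalSupRateTSlackOn (S : WinPred F) (b₀ p₀ a : ℝ) (σ : ℕ) (C : ℝ) : Prop :=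
  ∃ c : ℕ → ℕ → ℝ, ∀ (K n : ℕ) (h : n ≤ K), ∀ V : GaugeField (F.P n) 0 (Matrix.specialUnitaryGroup (Fin 2) ℂ), PlaqSmall (θBal F.L γ b₀ p₀ n) V →
    S K n h V → S (K + 1) n (h.trans (Nat.le_succ K)) V →
      |D.PintH (K + 1) n V - D.PintH K n V - c K n| ≤
        C * (Fintype.card (Site (F.P n) 0) : ℝ) * (θBal F.L γ b₀ p₀ n ^ 2 * (((F.L : ℝ) ^ (K - n))⁻¹) ^ a + θBal F.L γ b₀ p₀ n ^ σ)

/-- The full-window row implies the row on every sub-predicate. [cite: King1986, Thm 3.4 (3.9) p.656] -/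
theorem on_of_global (S : WinPred F) {b₀ p₀ a : ℝ} {σ : ℕ} {C : ℝ} (h : GlobalSupRateTSlack D b₀ p₀ a σ C) :
    GlobalSupRateTSlackOn D S b₀ p₀ a σ C := by
  obtain ⟨c, hc⟩ := h
  exact ⟨c, fun K n hn V hV _ _ => hc K n hn V hV⟩

/-- The row is antitone in the sub-predicate. [folklore] -/
theorem on_mono {S S' : WinPred F} (hSS' : ∀ K n h V, S K n h V → S' K n h V) {b₀ p₀ a : ℝ} {σ : ℕ} {C : ℝ}
    (h : GlobalSupRateTSlackOn D S' b₀ p₀ a σ C) : GlobalSupRateTSlackOn D S b₀ p₀ a σ C := by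
  obtain ⟨c, hc⟩ := h
  exact ⟨c, fun K n hn V hV hS hS1 => hc K n hn V hV (hSS' _ _ _ _ hS) (hSS' _ _ _ _ hS1)⟩

/-- On the trivial sub-predicate the row IS the full-window row. [folklore] -/
theorem on_true_iff {b₀ p₀ a : ℝ} {σ : ℕ} {C : ℝ} :
    GlobalSupRateTSlackOn D (fun _ _ _ _ => True) b₀ p₀ a σ C ↔ GlobalSupRateTSlack D b₀ p₀ a σ C := by
  refine ⟨fun ⟨c, hc⟩ => ⟨c, fun K n hn V hV => hc K n hn V hV trivial trivial⟩, on_of_global D _⟩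

end Defs

/-! ## §2 The counting, factored: the slack radii along the free fraction are summable -/

/-- **THE SLACK RADII ARE SUMMABLE** (pure counting; the body of the port's `cauchyAtHeights_of_globalSupRateTSlack`): for `1 < L`, `0 < γ ≤ 1`, `0 < b₀`, `0 < p₀`, `0 < a`,
`0 ≤ C`, `m > (3+a)/a` and a geometric profile `θ(n) ≤ C_θρⁿ` (`ρ ≥ 0`) with `ρ^σL³ < 1`,
`K ↦ C·|𝕋_{⌊K/m⌋}|·(θ(⌊K/m⌋)²·L^{−a(K−⌊K/m⌋)} + θ(⌊K/m⌋)^σ)` is summable (majorant `A·(L^{−(a−(3+a)/m)})^K + B·(q^{1/m})^K`, `q = max(ρ^σL³, ½)`).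
[cite: King1986, (3.12)-(3.13) p.657; Balaban1985UV3, (57) p.270] -/
theorem summable_slackRadii {b₀ p₀ a C Cθ ρ : ℝ} {σ m : ℕ}
    (hL : 1 < F.L) (hγ : 0 < γ) (hγ1 : γ ≤ 1) (hb : 0 < b₀) (hp : 0 < p₀) (ha : 0 < a) (hC : 0 ≤ C)
    (hm : (3 + a) / a < (m : ℝ)) (hρ : 0 ≤ ρ) (hθρ : ∀ n, θBal F.L γ b₀ p₀ n ≤ Cθ * ρ ^ n) (hρσ : ρ ^ σ * (F.L : ℝ) ^ 3 < 1) :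
    Summable fun K : ℕ => C * (Fintype.card (Site (F.P (K / m)) 0) : ℝ) *
      (θBal F.L γ b₀ p₀ (K / m) ^ 2 * (((F.L : ℝ) ^ (K - K / m))⁻¹) ^ a + θBal F.L γ b₀ p₀ (K / m) ^ σ) := by
  classical
  have hLr : (1 : ℝ) < (F.L : ℝ) := by exact_mod_cast hL
  have hL0 : (0 : ℝ) < (F.L : ℝ) := by linarith
  have hm0r : (0 : ℝ) < m := lt_trans (by positivity) hm
  have hm0 : 0 < m := by exact_mod_cast hm0r
  have hc0 : 0 < a - (3 + a) / m := by
    have : (3 + a) / (m : ℝ) < a := by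
      rw [div_lt_iff₀ hm0r]
      have := (div_lt_iff₀ ha).mp hm
      linarith
    linarith
  obtain ⟨hr0, hr1⟩ := rpow_neg_lt_one hLr hc0
  obtain ⟨Θ, hΘdef⟩ : ∃ Θ : ℝ, Θ = b₀ * ((2 * p₀) ^ p₀ * Real.exp (1 / 2 - p₀)) * Real.sqrt (Real.sqrt γ) := ⟨_, rfl⟩
  have hθΘ : ∀ i, θBal F.L γ b₀ p₀ i ≤ Θ := fun i => by
    rw [hΘdef]; exact T3Thresholds.θBal_le_const_mul_rpow hL.le hγ hγ1 hb.le hp i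
  have hθ0 : ∀ i, 0 < θBal F.L γ b₀ p₀ i := T3MinimiserStabilityReduction.θBal_pos hL.le hγ hγ1 hb p₀
  have hCθ : 0 ≤ Cθ := by
    have h := (hθ0 0).le.trans (hθρ 0)
    simpa using h
  obtain ⟨q, hqdef⟩ : ∃ q : ℝ, q = ρ ^ σ * (F.L : ℝ) ^ 3 := ⟨_, rfl⟩
  have hq0 : 0 ≤ q := by rw [hqdef]; positivity
  obtain ⟨q₁, hq₁def⟩ : ∃ q₁ : ℝ, q₁ = max q (1 / 2) := ⟨_, rfl⟩
  have hq₁0 : 0 < q₁ := by rw [hq₁def]; exact lt_of_lt_of_le (by norm_num) (le_max_right _ _)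
  have hq₁1 : q₁ < 1 := by rw [hq₁def, hqdef]; exact max_lt hρσ (by norm_num)
  have hqq₁ : q ≤ q₁ := by rw [hq₁def]; exact le_max_left _ _
  obtain ⟨r₁, hr₁def⟩ : ∃ r₁ : ℝ, r₁ = (F.L : ℝ) ^ (-(a - (3 + a) / m)) := ⟨_, rfl⟩
  obtain ⟨r₂, hr₂def⟩ : ∃ r₂ : ℝ, r₂ = q₁ ^ (1 / (m : ℝ)) := ⟨_, rfl⟩
  have hr₂0 : 0 ≤ r₂ := by rw [hr₂def]; positivity
  have hr₂1 : r₂ < 1 := by rw [hr₂def]; exact Real.rpow_lt_one hq₁0.le hq₁1 (by positivity)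
  obtain ⟨A, hAdef⟩ : ∃ A : ℝ, A = C * 8 * (F.L : ℝ) ^ (3 * F.m) * Θ ^ 2 := ⟨_, rfl⟩
  obtain ⟨B, hBdef⟩ : ∃ B : ℝ, B = C * 8 * (F.L : ℝ) ^ (3 * F.m) * Cθ ^ σ * q₁⁻¹ := ⟨_, rfl⟩
  have hnn : ∀ K, 0 ≤ C * (Fintype.card (Site (F.P (K / m)) 0) : ℝ) *
      (θBal F.L γ b₀ p₀ (K / m) ^ 2 * (((F.L : ℝ) ^ (K - K / m))⁻¹) ^ a + θBal F.L γ b₀ p₀ (K / m) ^ σ) := fun K =>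
    mul_nonneg (mul_nonneg hC (Nat.cast_nonneg _))
      (add_nonneg (mul_nonneg (pow_nonneg (hθ0 _).le 2) (Real.rpow_nonneg (inv_nonneg.mpr (pow_nonneg hL0.le _)) a))
        (pow_nonneg (hθ0 _).le σ))
  have hmaj : Summable fun K : ℕ => A * r₁ ^ K + B * r₂ ^ K := by
    rw [hr₁def]
    exact ((summable_geometric_of_lt_one hr0.le hr1).mul_left A).add ((summable_geometric_of_lt_one hr₂0 hr₂1).mul_left B)
  refine hmaj.of_nonneg_of_le hnn fun K => ?_
  rw [card_site_zero]
  -- the rate term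
  have h1 : C * (8 * (F.L : ℝ) ^ (3 * (F.m + K / m))) * (θBal F.L γ b₀ p₀ (K / m) ^ 2 * (((F.L : ℝ) ^ (K - K / m))⁻¹) ^ a) ≤
      A * r₁ ^ K := by
    have hθ2 : θBal F.L γ b₀ p₀ (K / m) ^ 2 ≤ Θ ^ 2 := pow_le_pow_left₀ (hθ0 _).le (hθΘ _) 2
    have hpow : (F.L : ℝ) ^ (3 * (F.m + K / m)) * (((F.L : ℝ) ^ (K - K / m))⁻¹) ^ a =
        (F.L : ℝ) ^ (3 * F.m) * (F.L : ℝ) ^ ((3 * (K / m : ℕ) - a * (K - K / m : ℕ) : ℝ)) := by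
      rw [inv_pow_rpow_eq_rpow hL0, mul_add, pow_add, ← Real.rpow_natCast (F.L : ℝ) (3 * (K / m)), mul_assoc, ← Real.rpow_add hL0]
      congr 2
      push_cast
      ring
    have hff : (F.L : ℝ) ^ ((3 * (K / m : ℕ) - a * (K - K / m : ℕ) : ℝ)) ≤ r₁ ^ K := by
      rw [hr₁def]; exact rpow_free_fraction_le hLr ha.le hm0 K
    have hXnn : 0 ≤ (F.L : ℝ) ^ ((3 * (K / m : ℕ) - a * (K - K / m : ℕ) : ℝ)) := Real.rpow_nonneg hL0.le _
    calc C * (8 * (F.L : ℝ) ^ (3 * (F.m + K / m))) * (θBal F.L γ b₀ p₀ (K / m) ^ 2 * (((F.L : ℝ) ^ (K - K / m))⁻¹) ^ a)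
        = C * 8 * θBal F.L γ b₀ p₀ (K / m) ^ 2 * ((F.L : ℝ) ^ (3 * (F.m + K / m)) * (((F.L : ℝ) ^ (K - K / m))⁻¹) ^ a) := by ring
      _ = C * 8 * θBal F.L γ b₀ p₀ (K / m) ^ 2 * ((F.L : ℝ) ^ (3 * F.m) * (F.L : ℝ) ^ ((3 * (K / m : ℕ) - a * (K - K / m : ℕ) : ℝ))) := by
          rw [hpow]
      _ ≤ C * 8 * Θ ^ 2 * ((F.L : ℝ) ^ (3 * F.m) * r₁ ^ K) :=
          mul_le_mul (mul_le_mul_of_nonneg_left hθ2 (by positivity)) (mul_le_mul_of_nonneg_left hff (by positivity))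
            (mul_nonneg (by positivity) hXnn) (by positivity)
      _ = A * r₁ ^ K := by rw [hAdef]; ring
  -- the slack term
  have h2 : C * (8 * (F.L : ℝ) ^ (3 * (F.m + K / m))) * θBal F.L γ b₀ p₀ (K / m) ^ σ ≤ B * r₂ ^ K := by
    have hθσ : θBal F.L γ b₀ p₀ (K / m) ^ σ ≤ Cθ ^ σ * (ρ ^ σ) ^ (K / m) := by
      calc θBal F.L γ b₀ p₀ (K / m) ^ σ ≤ (Cθ * ρ ^ (K / m)) ^ σ := pow_le_pow_left₀ (hθ0 _).le (hθρ _) σ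
        _ = Cθ ^ σ * (ρ ^ σ) ^ (K / m) := by rw [mul_pow, ← pow_mul, ← pow_mul, mul_comm (K / m) σ]
    have hL3 : (F.L : ℝ) ^ (3 * (F.m + K / m)) = (F.L : ℝ) ^ (3 * F.m) * ((F.L : ℝ) ^ 3) ^ (K / m) := by
      rw [← pow_mul, ← pow_add, ← mul_add]
    have hqK : (ρ ^ σ) ^ (K / m) * ((F.L : ℝ) ^ 3) ^ (K / m) = q ^ (K / m) := by rw [hqdef, mul_pow]
    have hq₁K : q ^ (K / m) ≤ q₁ ^ (K / m) := pow_le_pow_left₀ hq0 hqq₁ _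
    have hgeom : q₁ ^ (K / m) ≤ q₁⁻¹ * r₂ ^ K := by rw [hr₂def]; exact pow_div_le_geom hq₁0 hq₁1.le hm0 K
    calc C * (8 * (F.L : ℝ) ^ (3 * (F.m + K / m))) * θBal F.L γ b₀ p₀ (K / m) ^ σ
        ≤ C * (8 * (F.L : ℝ) ^ (3 * (F.m + K / m))) * (Cθ ^ σ * (ρ ^ σ) ^ (K / m)) :=
          mul_le_mul_of_nonneg_left hθσ (by positivity)
      _ = C * 8 * (F.L : ℝ) ^ (3 * F.m) * Cθ ^ σ * ((ρ ^ σ) ^ (K / m) * ((F.L : ℝ) ^ 3) ^ (K / m)) := by rw [hL3]; ring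
      _ = C * 8 * (F.L : ℝ) ^ (3 * F.m) * Cθ ^ σ * q ^ (K / m) := by rw [hqK]
      _ ≤ C * 8 * (F.L : ℝ) ^ (3 * F.m) * Cθ ^ σ * (q₁⁻¹ * r₂ ^ K) :=
          mul_le_mul_of_nonneg_left (hq₁K.trans hgeom) (by positivity)
      _ = B * r₂ ^ K := by rw [hBdef]; ring
  calc C * (8 * (F.L : ℝ) ^ (3 * (F.m + K / m))) *
        (θBal F.L γ b₀ p₀ (K / m) ^ 2 * (((F.L : ℝ) ^ (K - K / m))⁻¹) ^ a + θBal F.L γ b₀ p₀ (K / m) ^ σ)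
      = C * (8 * (F.L : ℝ) ^ (3 * (F.m + K / m))) * (θBal F.L γ b₀ p₀ (K / m) ^ 2 * (((F.L : ℝ) ^ (K - K / m))⁻¹) ^ a) +
          C * (8 * (F.L : ℝ) ^ (3 * (F.m + K / m))) * θBal F.L γ b₀ p₀ (K / m) ^ σ := by ring
    _ ≤ A * r₁ ^ K + B * r₂ ^ K := add_le_add h1 h2

/-- The slack radii are non-negative (`L ≥ 1`, `0 < γ ≤ 1`, `0 < b₀`, `0 ≤ C`). [folklore] -/
theorem slackRadii_nonneg {b₀ p₀ a C : ℝ} {σ m : ℕ} (hL : 1 ≤ F.L) (hγ : 0 < γ) (hγ1 : γ ≤ 1) (hb : 0 < b₀) (hC : 0 ≤ C) (K : ℕ) :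
    0 ≤ C * (Fintype.card (Site (F.P (K / m)) 0) : ℝ) *
      (θBal F.L γ b₀ p₀ (K / m) ^ 2 * (((F.L : ℝ) ^ (K - K / m))⁻¹) ^ a + θBal F.L γ b₀ p₀ (K / m) ^ σ) := by
  have hθ0 : ∀ i, 0 < θBal F.L γ b₀ p₀ i := T3MinimiserStabilityReduction.θBal_pos hL hγ hγ1 hb p₀
  exact mul_nonneg (mul_nonneg hC (Nat.cast_nonneg _))
    (add_nonneg (mul_nonneg (pow_nonneg (hθ0 _).le 2) (Real.rpow_nonneg (inv_nonneg.mpr (pow_nonneg (Nat.cast_nonneg _) _)) a))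
      (pow_nonneg (hθ0 _).le σ))

/-! ## §3 (b1): the χ-restricted socket from the row on `S` -/

section Consumer

variable (D : AlphaDataT3 F γ)

/-- **THE RESTRICTED SOCKET FROM A WINDOW BOUND ON `S`** (bookkeeping): summable `r′ ≥ 0`, shifts `c`, and the sup bound on the doubly-`S`-good part of the
`θ(⌊K/m⌋)`-window give `PrintChi.PintCauchyOn F γ b₀ p₀ S m D.PintH` (its a.e. and positivity guards are not needed). [cite: King1986, Thm 3.4 (3.9) p.656] -/
theorem pintCauchyOn_of_windowBoundOn (S : WinPred F) {b₀ p₀ : ℝ} {m : ℕ} (r' c : ℕ → ℝ) (hs : Summable r') (h0 : ∀ K, 0 ≤ r' K)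
    (h : ∀ (K : ℕ) (V : GaugeField (F.P (K / m)) 0 (Matrix.specialUnitaryGroup (Fin 2) ℂ)), PlaqSmall (θBal F.L γ b₀ p₀ (K / m)) V →
      S K (K / m) (Nat.div_le_self K m) V → S (K + 1) (K / m) ((Nat.div_le_self K m).trans (Nat.le_succ K)) V →
        |D.PintH (K + 1) (K / m) V - D.PintH K (K / m) V - c K| ≤ r' K) :
    PintCauchyOn F γ b₀ p₀ S m D.PintH :=
  ⟨r', c, hs, h0, fun K => ae_of_all _ fun V hV hS hS' _ _ => h K V hV hS hS'⟩

/-- **(b1) THE χ-RESTRICTED SOCKET FROM THE ROW ON `S`** (pure counting, no block-size threshold): for `1 < L`, `0 < γ ≤ 1`, `0 < b₀`, `0 < p₀`, `0 < a`, `0 ≤ C`,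
`m > (3+a)/a`, a geometric threshold profile `θ(n) ≤ C_θρⁿ` (`ρ ≥ 0`) with `ρ^σL³ < 1`: `GlobalSupRateTSlackOn D S b₀ p₀ a σ C ⟹ PrintChi.PintCauchyOn F γ b₀ p₀ S m D.PintH`.
[cite: King1986, Thm 3.4 (3.9) p.656 and (3.12)-(3.13) p.657] -/
theorem cauchyOn_of_globalSupRateTSlackOn (S : WinPred F) {b₀ p₀ a C Cθ ρ : ℝ} {σ m : ℕ}
    (hL : 1 < F.L) (hγ : 0 < γ) (hγ1 : γ ≤ 1) (hb : 0 < b₀) (hp : 0 < p₀) (ha : 0 < a) (hC : 0 ≤ C)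
    (hm : (3 + a) / a < (m : ℝ)) (hρ : 0 ≤ ρ) (hθρ : ∀ n, θBal F.L γ b₀ p₀ n ≤ Cθ * ρ ^ n) (hρσ : ρ ^ σ * (F.L : ℝ) ^ 3 < 1)
    (h : GlobalSupRateTSlackOn D S b₀ p₀ a σ C) :
    PintCauchyOn F γ b₀ p₀ S m D.PintH := by
  obtain ⟨c, hc⟩ := h
  exact pintCauchyOn_of_windowBoundOn D S _ (fun K => c K (K / m)) (summable_slackRadii hL hγ hγ1 hb hp ha hC hm hρ hθρ hρσ)
    (slackRadii_nonneg hL.le hγ hγ1 hb hC) (fun K V hV hS hS' => hc K (K / m) (Nat.div_le_self K m) V hV hS hS')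

/-- **(b1), SHARP PROFILE, `σ ≥ 7`** (print's «overall power greater than six»; `c = 1/8`: `ρ = L^{−7/16}`, `ρ⁷L³ = L^{−1/16} < 1`): for `1 < L`, `0 < γ ≤ 1`, `0 < b₀`,
`0 < p₀`, `0 < a`, `0 ≤ C`, `m > (3+a)/a`, `7 ≤ σ`: `GlobalSupRateTSlackOn D S b₀ p₀ a σ C ⟹ PrintChi.PintCauchyOn F γ b₀ p₀ S m D.PintH`.
[cite: Balaban1985UV3, (57) p.270; King1986, Thm 3.4 (3.9) p.656] -/
theorem cauchyOn_of_globalSupRateTSlackOn_seven (S : WinPred F) {b₀ p₀ a C : ℝ} {σ m : ℕ}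
    (hL : 1 < F.L) (hγ : 0 < γ) (hγ1 : γ ≤ 1) (hb : 0 < b₀) (hp : 0 < p₀) (ha : 0 < a) (hC : 0 ≤ C)
    (hm : (3 + a) / a < (m : ℝ)) (hσ : 7 ≤ σ) (h : GlobalSupRateTSlackOn D S b₀ p₀ a σ C) :
    PintCauchyOn F γ b₀ p₀ S m D.PintH := by
  have hc : (0 : ℝ) < 1 / 8 := by norm_num
  have hσr : (7 : ℝ) ≤ σ := by exact_mod_cast hσ
  refine cauchyOn_of_globalSupRateTSlackOn D S hL hγ hγ1 hb hp ha hC hm (ρ := ((F.L : ℝ)⁻¹) ^ ((1 - 1 / 8 : ℝ) / 2))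
    (Cθ := b₀ * ((p₀ / (1 / 8)) ^ p₀ * Real.exp (1 / 8 - p₀)) * γ ^ ((1 - 1 / 8 : ℝ) / 2))
    (by positivity) (fun n => θBal_le_geometric_sharp hL.le hγ hγ1 hb.le hp hc n) ?_ h
  exact slack_ratio_lt_one hL (by nlinarith)

/-- **THE FULL SOCKET IS THE CASE `S = ⊤`** (sanity: the port's `cauchyAtHeights_of_globalSupRateTSlack_seven` recovered through the restricted one).
[cite: King1986, Thm 3.4 (3.9) p.656] -/
theorem cauchyAtHeights_of_on_true {b₀ p₀ a C : ℝ} {σ m : ℕ}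
    (hL : 1 < F.L) (hγ : 0 < γ) (hγ1 : γ ≤ 1) (hb : 0 < b₀) (hp : 0 < p₀) (ha : 0 < a) (hC : 0 ≤ C)
    (hm : (3 + a) / a < (m : ℝ)) (hσ : 7 ≤ σ) (h : GlobalSupRateTSlackOn D (fun _ _ _ _ => True) b₀ p₀ a σ C) :
    CauchyAtHeights D b₀ p₀ m := by
  obtain ⟨r', c, hs, h0, hae⟩ := cauchyOn_of_globalSupRateTSlackOn_seven D _ hL hγ hγ1 hb hp ha hC hm hσ h
  refine ⟨r', c, hs, h0, fun K => ?_⟩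
  filter_upwards [hae K] with V hV
  exact fun hs' h1 h2 => hV hs' trivial trivial h1 h2

end Consumer

/-! ## §4 The registered-shape slot (drop-in next to `landed_levelCauchyOfGlobalSupRateTSlack`, with the sub-predicate quantified after the family) -/

/-- **THE χ-RESTRICTED S-E″ SLOT, REGISTERED QUANTIFIER SHAPE** (`ε₁ = γ₁ = 1`, `m₀ = ⌈(3+a)/a⌉ + 1`; `σ ≥ 7`, `C ≥ 0` and the sub-predicate `S` may depend on the family):
`GlobalSupRateTSlackOn D S b₀ p₀ a σ C → PrintChi.PintCauchyOn F γ b₀ p₀ S m D.PintH` — no block-size threshold, so it serves `L ∈ {3,5}`. [cite: King1986, Thm 3.4 (3.9) p.656] -/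
theorem levelCauchyOnOfGlobalSupRateTSlackOn_dec :
    ∀ (L : ℕ), Odd L → 1 < L → ∀ (a : ℝ), 0 < a →
      ∃ ε₁ : ℝ, 0 < ε₁ ∧ ∀ (ε₀ : ℝ), 0 < ε₀ → ε₀ ≤ ε₁ → ∃ m₀ : ℕ, ∀ (m : ℕ), m₀ ≤ m → ∀ (b₀ p₀ : ℝ), 0 < b₀ → 2 < p₀ →
        ∃ γ₁ : ℝ, 0 < γ₁ ∧ ∀ (F : T3Family) (γ : ℝ), F.L = L → 0 < γ → γ ≤ γ₁ →
          ∀ (S : WinPred F) (D : AlphaDataT3 F γ) (σ : ℕ) (C : ℝ), 7 ≤ σ → 0 ≤ C →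
            GlobalSupRateTSlackOn D S b₀ p₀ a σ C → PintCauchyOn F γ b₀ p₀ S m D.PintH := by
  intro L _ hL a ha
  refine ⟨1, one_pos, fun ε₀ _ _ => ⟨Nat.ceil ((3 + a) / a) + 1, fun m hm b₀ p₀ hb hp => ?_⟩⟩
  refine ⟨1, one_pos, fun F γ hF hγ hγ1 S D σ C hσ hC h => ?_⟩
  have hL' : 1 < F.L := by rw [hF]; exact hL
  exact cauchyOn_of_globalSupRateTSlackOn_seven D S hL' hγ hγ1 hb (by linarith) ha hC (lt_of_ceil_succ_le hm) hσ h

end Summit.QuantumFields.YangMills.Theorems.GlobalSlackOn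

end
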